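import Summits.BirchSwinnertonDyer.BirchSwinnertonDyer.Theorems.AlignedTransportAtTwoMainConjectureTransportAlignedAtTwoOrdPlusLineWitnessMinusTable
import Summits.BirchSwinnertonDyer.BirchSwinnertonDyer.Theorems.AlignedTransportAtTwoMainConjectureTransportAlignedAtTwoKilfordStratumShared
import HarnessLib

/-!
# Crux C1 `MainConjectureTransportAlignedAtTwo` (stmt-BirchSwinnertonDyer-22296), line `birth`, the `Δ > 0` half (R1) of the promoted residual:
# «EITHER CURVE MAY CARRY THE WITNESS» — the table witness on the SECOND curve also gives the `λ`-law (width seat att-p4 g12; `--supports 22296`)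

THEOREMS ONLY (no `def`, no `sorry`, no new named fact). BSD is not proved by this; C1 is not closed by this.

`…WitnessMinusTable.lamLaw_of_not_padicSquare_of_minusTable_witness` asks for a non-`2`-integral depleted MINUS value of the FIRST curve at a symmetric
cusp of the admissible level. The conclusion (the `λ`-law) is symmetric in the pair and the off-stratum hypothesis `Δ(W₁) ∉ ℚ₂²` transfers across the
shared cubic field (att-p4 g11 `…KilfordStratumShared.forall_sq_ne_of_sharedCubicField`), so the same law follows from the witness on the SECOND curve:
`lamLaw_of_not_padicSquare_of_minusTable_witness_right`. Hence the witness route has TWO chances per pair, and the level-transport no-go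
(`…WitnessMinusTableLevel.not_minusTable_witness_of_periodFunctional_even`) kills it only when BOTH curves have even symmetric minus values at their own
levels (e.g. both conductors odd prime powers — `Cruxes/…/DELTA-POS-WITNESS-att-p4-g12.md` §2(e)).

References: Greenberg–Vatsal 2000 Thm. (1.4), §3 Rem. 3.4 [GreenbergVatsal2000]; Buzzard 2000 Prop. 2.4 [Buzzard2000LevelLoweringModTwo];
Mazur–Tate–Teitelbaum 1986 §I.8, §I.10 [MazurTateTeitelbaum1986Invent].
-/

noncomputable section

-- justification: the `Summit.BirchSwinnertonDyer.BirchSwinnertonDyer.…` path repeats a component (route-file convention)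
set_option linter.dupNamespace false
set_option autoImplicit false

open scoped MatrixGroups ModularForm NumberField Classical
open CongruenceSubgroup Complex WeierstrassCurve IsDedekindDomain Polynomial Module
open Literature.NumberTheory.EllipticCurves Literature.NumberTheory.EllipticCurves.ModularForms
open Literature.NumberTheory.EllipticCurves.Greenberg1999 Literature.NumberTheory.EllipticCurves.GreenbergVatsal2000
open Summit.BirchSwinnertonDyer.Rank1Residual.F1Sign2 Summit.BirchSwinnertonDyer.Rank1Residual.X1.MuLambda
open Summit.BirchSwinnertonDyer.BirchSwinnertonDyer.Theorems.AlignedTransportAtTwoOrdPlusLineWitnessMinusTable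
open Summit.BirchSwinnertonDyer.BirchSwinnertonDyer.Theorems.AlignedTransportAtTwoKilfordStratumShared

namespace Summit.BirchSwinnertonDyer.BirchSwinnertonDyer.Theorems.AlignedTransportAtTwoOrdPlusLineWitnessMinusTableSymm

/-- **The `λ`-law off the Kilford stratum from the table witness on the SECOND curve.** Hypotheses of
`…WitnessMinusTable.lamLaw_of_not_padicSquare_of_minusTable_witness` (in particular `Δ(W₁) ∉ ℚ₂²`, which transfers to `W₂`), with the witness
«`∃ (a b; c a) ∈ Γ₀(N')`, `c ≠ 0`, `1 < ‖(eulerDepleteTableList W₂ l [·]⁻_{f₂})(a/c)‖₂`» about `W₂`; same conclusion.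
[cite: GreenbergVatsal2000, Thm. (1.4) and §3 Remark 3.4] [cite: Buzzard2000LevelLoweringModTwo, Prop. 2.4] [cite: MazurTateTeitelbaum1986Invent, §I.8 and §I.10] -/
theorem lamLaw_of_not_padicSquare_of_minusTable_witness_right
    (hSD : heckeSelfDual_torsionBy_J0) (hBz : buzzard2000_multiplicityOne_gamma0)
    (W₁ : WeierstrassCurve ℚ) [W₁.IsElliptic] [W₁.IsGloballyMinimal]
    (W₂ : WeierstrassCurve ℚ) [W₂.IsElliptic] [W₂.IsGloballyMinimal]
    (hord₁ : IsOrdinaryAt W₁ 2) (hord₂ : IsOrdinaryAt W₂ 2)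
    (ht₁ : ∀ x : ℚ, ¬ HasRationalTwoTorsionX W₁ x) (ht₂ : ∀ x : ℚ, ¬ HasRationalTwoTorsionX W₂ x)
    (hΔ₂ : ∀ s : ℚ_[2], s ^ 2 ≠ (W₁.Δ : ℚ_[2]))
    {F : Type} [Field F] [NumberField F] (hF : finrank ℚ F = 3)
    {e₁ e₂ : F} (he₁ : aeval e₁ (twoDivisionUCubic W₁) = 0) (he₂ : aeval e₂ (twoDivisionUCubic W₂) = 0)
    [NeZero (W₁.conductorNorm ℤ)] [NeZero (W₂.conductorNorm ℤ)]
    {f₁ : CuspForm (Gamma0 (W₁.conductorNorm ℤ)) 2} (hf₁ : IsNewformOf W₁ f₁)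
    {f₂ : CuspForm (Gamma0 (W₂.conductorNorm ℤ)) 2} (hf₂ : IsNewformOf W₂ f₂)
    {G₁ G₂ : IwasawaAlgebra 2} (hG₁ : IsEvenBranchLiftAtTwo W₁ f₁ G₁) (hG₂ : IsEvenBranchLiftAtTwo W₂ f₂ G₂)
    {q₀ : ℕ} (hq₀ : q₀.Prime) (hq₀2 : q₀ ≠ 2) (hq₀N : ¬ q₀ ∣ W₁.conductorNorm ℤ * W₂.conductorNorm ℤ)
    (l : List (HeightOneSpectrum (𝓞 ℚ))) (hl : l.Nodup)
    (hlSS : (l.map Rat.HeightOneSpectrum.natGenerator).toFinset = (q₀ * (W₁.conductorNorm ℤ * W₂.conductorNorm ℤ)).primeFactors.erase 2)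
    (N' : ℕ) [NeZero N']
    (hN' : N' = q₀ * (W₁.conductorNorm ℤ * W₂.conductorNorm ℤ) * ∏ ℓ ∈ (l.map Rat.HeightOneSpectrum.natGenerator).toFinset, ℓ ^ 2)
    (g₁ g₂ : CuspForm (Gamma0 N') 2)
    (hg₁ : ∀ n : ℕ, cuspCoeff g₁ n = if ∃ ℓ ∈ (l.map Rat.HeightOneSpectrum.natGenerator).toFinset, ℓ ∣ n then 0 else cuspCoeff f₁ n)
    (hg₂ : ∀ n : ℕ, cuspCoeff g₂ n = if ∃ ℓ ∈ (l.map Rat.HeightOneSpectrum.natGenerator).toFinset, ℓ ∣ n then 0 else cuspCoeff f₂ n)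
    (hII : ∃ γ : Gamma0 N', (γ : SL(2, ℤ)) 0 0 = (γ : SL(2, ℤ)) 1 1 ∧ (γ : SL(2, ℤ)) 1 0 ≠ 0 ∧
      1 < ‖((eulerDepleteTableList W₂ l (ratMinusSymbol f₂)
        ((((γ : SL(2, ℤ)) 0 0 : ℤ) : ℚ) / (((γ : SL(2, ℤ)) 1 0 : ℤ) : ℚ)) : ℚ) : ℚ_[2])‖) :
    lam G₁ + ∑ ℓ ∈ (W₁.conductorNorm ℤ * W₂.conductorNorm ℤ).primeFactors.erase 2, lambdaCorrectionAtTwo W₁ ℓ =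
      lam G₂ + ∑ ℓ ∈ (W₁.conductorNorm ℤ * W₂.conductorNorm ℤ).primeFactors.erase 2, lambdaCorrectionAtTwo W₂ ℓ := by
  have hΔ₂' : ∀ s : ℚ_[2], s ^ 2 ≠ (W₂.Δ : ℚ_[2]) := forall_sq_ne_of_sharedCubicField W₁ W₂ hF ht₁ ht₂ he₁ he₂ hord₂ hΔ₂
  have hcomm : W₁.conductorNorm ℤ * W₂.conductorNorm ℤ = W₂.conductorNorm ℤ * W₁.conductorNorm ℤ := mul_comm _ _
  rw [hcomm] at hq₀N hlSS hN' ⊢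
  exact (lamLaw_of_not_padicSquare_of_minusTable_witness hSD hBz W₂ W₁ hord₂ hord₁ ht₂ ht₁ hΔ₂' hF he₂ he₁ hf₂ hf₁ hG₂ hG₁ hq₀ hq₀2 hq₀N
    l hl hlSS N' hN' g₂ g₁ hg₂ hg₁ hII).symm

end Summit.BirchSwinnertonDyer.BirchSwinnertonDyer.Theorems.AlignedTransportAtTwoOrdPlusLineWitnessMinusTableSymm

end
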